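import Literature.Geometry.DiscreteGeometry.TwoShellPatterns
import HarnessLib

/-!
# The two shells of a good particle: exactly twelve near neighbours, then a gap, then six

Companion of `TwoShellPatterns.lean` (which leaves "the finer count 'exactly `12` within `(1+ε)a`'"
to consumers).  For an `ε`-good particle `i` (`IsTwoShellGood ε aLo aHi x i`, scale window with
`0 < aLo`) and `0 ≤ ε < (√2 − 1)/2` (so the route's `ε = 1/20`), at the witnessing scale `a`:

* exactly `12` other particles lie within distance `(1 + ε)·a` of `x i` (the images of the first
  shell of the pattern), and
* exactly the same `12` lie within the OPEN ball of radius `(√2 − ε)·a` — no particle has distance in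
  the gap `((1 + ε)a, (√2 − ε)a)`; the remaining `6` of the `18` particles within `3a/2` are the
  second shell, at distances in `[(√2 − ε)a, (√2 + ε)a]`.

This is the combinatorial input ("contact graph = first shell, octahedral caps = second shell") of
every local chart argument for good regions (Hales, *Dense Sphere Packings* §1.3 for the exact
patterns).  Ingredients: both two-shell patterns have exactly `12` points of norm `1` (the kissing
pattern) and `6` of norm `√2` (`card_filter_norm_eq_one_of_twoShellPattern`), and the two-way
`ε·a`-match moves distances by at most `ε·a`.

## References
* T. C. Hales, *Dense Sphere Packings: a blueprint for formal proofs* (2012), §1.3. [HalesDSP2012]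
-/

noncomputable section

namespace Literature.Geometry.DiscreteGeometry

open Finset

/-! ### The second shells inside the patterns -/

/-- Six integer vectors. [folklore] -/
theorem card_fccSecondShellInt : fccSecondShellInt.card = 6 := by decide

/-- Six integer vectors. [folklore] -/
theorem card_hcpSecondShellInt : hcpSecondShellInt.card = 6 := by decide

/-- **Each two-shell pattern has exactly twelve points of norm `1`** (its kissing pattern; the other
six have norm `√2`). [cite: HalesDSP2012, §1.3] -/
theorem card_filter_norm_eq_one_of_twoShellPattern {P : Finset (EuclideanSpace ℝ (Fin 3))}
    (hP : P = fccTwoShellPattern ∨ P = hcpTwoShellPattern) :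
    (P.filter fun v => ‖v‖ = 1).card = 12 := by
  classical
  have hs2 : Real.sqrt 2 ≠ 1 := by
    have : (1 : ℝ) < Real.sqrt 2 := by
      rw [show (1 : ℝ) = Real.sqrt 1 from Real.sqrt_one.symm]
      exact Real.sqrt_lt_sqrt (by norm_num) (by norm_num)
    exact this.ne'
  have hfcc4 : ∀ w ∈ fccSecondShellInt, sqNormInt w = 4 := by decide
  have hhcp36 : ∀ w ∈ hcpSecondShellInt, sqNormInt w = 36 := by decide
  -- a generic count: `K ⊆ P` twelve points of norm one, `S ⊆ P` six points of norm `√2`, `#P = 18`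
  have key : ∀ (K S : Finset (EuclideanSpace ℝ (Fin 3))), K ⊆ P → S ⊆ P → K.card = 12 → S.card = 6 →
      P.card = 18 → (∀ v ∈ K, ‖v‖ = 1) → (∀ v ∈ S, ‖v‖ = Real.sqrt 2) →
      (P.filter fun v => ‖v‖ = 1).card = 12 := by
    intro K S hK hS hKc hSc hPc hKn hSn
    apply le_antisymm
    · -- `filter ⊆ P \\ S`
      have hsub : (P.filter fun v => ‖v‖ = 1) ⊆ P \ S := by
        intro v hv
        rw [Finset.mem_filter] at hv
        rw [Finset.mem_sdiff]
        exact ⟨hv.1, fun hvS => hs2 (by rw [← hSn v hvS, hv.2])⟩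
      have := Finset.card_le_card hsub
      rw [Finset.card_sdiff_of_subset hS, hPc, hSc] at this
      exact this
    · have hsub : K ⊆ P.filter fun v => ‖v‖ = 1 := fun v hv =>
        Finset.mem_filter.2 ⟨hK hv, hKn v hv⟩
      simpa [hKc] using Finset.card_le_card hsub
  rcases hP with rfl | rfl
  · refine key fccKissingPattern (scaledPattern fccSecondShellInt 2) fccKissingPattern_subset
      (Finset.image_subset_image Finset.subset_union_right) card_fccKissingPattern
      (by rw [card_scaledPattern _ two_ne_zero, card_fccSecondShellInt]) card_fccTwoShellPattern
      (fun v hv => norm_eq_one_of_mem_fccKissingPattern hv) ?_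
    intro v hv
    obtain ⟨w, hw, h⟩ := norm_of_mem_scaledPattern two_ne_zero hv
    rw [h, hfcc4 w hw]
    norm_num
  · refine key hcpKissingPattern (scaledPattern hcpSecondShellInt 18) hcpKissingPattern_subset
      (Finset.image_subset_image Finset.subset_union_right) card_hcpKissingPattern
      (by rw [card_scaledPattern _ (by norm_num), card_hcpSecondShellInt]) card_hcpTwoShellPattern
      (fun v hv => norm_eq_one_of_mem_hcpKissingPattern hv) ?_
    intro v hv
    obtain ⟨w, hw, h⟩ := norm_of_mem_scaledPattern (by norm_num) hv
    rw [h, hhcp36 w hw]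
    norm_num

/-- Points of either two-shell pattern have norm `1` or `√2`. [cite: HalesDSP2012, §1.3] -/
theorem norm_of_mem_twoShellPattern {P : Finset (EuclideanSpace ℝ (Fin 3))}
    (hP : P = fccTwoShellPattern ∨ P = hcpTwoShellPattern) {v : EuclideanSpace ℝ (Fin 3)}
    (hv : v ∈ P) : ‖v‖ = 1 ∨ ‖v‖ = Real.sqrt 2 := by
  rcases hP with rfl | rfl
  · exact norm_of_mem_fccTwoShellPattern hv
  · exact norm_of_mem_hcpTwoShellPattern hv

namespace IsTwoShellGood

variable {ε aLo aHi : ℝ} {N : ℕ} {x : Fin N → EuclideanSpace ℝ (Fin 3)} {i : Fin N}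

/-- **The first shell of a good particle.**  If `i` is `ε`-good on a window of positive scales and
`0 ≤ ε < (√2 − 1)/2`, then at the witnessing scale `a` exactly `12` other particles lie within
`(1 + ε)a` of `x i`, and exactly `12` (the same ones) lie at distance `< (√2 − ε)a`: the gap
`((1+ε)a, (√2−ε)a)` is empty and the other six particles within `3a/2` form the second shell.
[cite: HalesDSP2012, §1.3] -/
theorem card_filter_firstShell (h : IsTwoShellGood ε aLo aHi x i) (haLo : 0 < aLo) (hε0 : 0 ≤ ε)
    (hε : ε < (Real.sqrt 2 - 1) / 2) :
    ∃ a : ℝ, aLo ≤ a ∧ a ≤ aHi ∧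
      (Finset.univ.filter fun j : Fin N => j ≠ i ∧ dist (x j) (x i) ≤ (1 + ε) * a).card = 12 ∧
      (Finset.univ.filter fun j : Fin N => j ≠ i ∧ dist (x j) (x i) < (Real.sqrt 2 - ε) * a).card
        = 12 := by
  classical
  obtain ⟨a, ha₁, ha₂, A, P, f, hP, hf, hinj, hsurj⟩ := h
  have ha : 0 < a := haLo.trans_le ha₁
  have hs2 : (1 : ℝ) < Real.sqrt 2 := by
    rw [show (1 : ℝ) = Real.sqrt 1 from Real.sqrt_one.symm]
    exact Real.sqrt_lt_sqrt (by norm_num) (by norm_num)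
  have hs2' : Real.sqrt 2 < 3 / 2 := by
    rw [show (3 / 2 : ℝ) = Real.sqrt (9 / 4) by
      rw [show (9 / 4 : ℝ) = (3 / 2) ^ 2 by norm_num, Real.sqrt_sq (by norm_num)]]
    exact Real.sqrt_lt_sqrt (by norm_num) (by norm_num)
  refine ⟨a, ha₁, ha₂, ?_⟩
  -- distances of assigned particles: `| dist (x (f v)) (x i) − a ‖v‖ | ≤ ε a`
  have hdist : ∀ v ∈ P, a * ‖v‖ - ε * a ≤ dist (x (f v)) (x i) ∧
      dist (x (f v)) (x i) ≤ a * ‖v‖ + ε * a := by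
    intro v hv
    have h1 : dist (x i + a • A v) (x i) = a * ‖v‖ := by
      rw [dist_eq_norm, add_sub_cancel_left, norm_smul, Real.norm_of_nonneg ha.le, A.norm_map]
    have h2 := abs_dist_sub_le (x (f v)) (x i + a • A v) (x i)
    rw [h1] at h2
    have h3 := (hf v hv).2
    constructor
    · linarith [(abs_le.1 (h2.trans h3)).1]
    · linarith [(abs_le.1 (h2.trans h3)).2]
  set P₁ : Finset (EuclideanSpace ℝ (Fin 3)) := P.filter fun v => ‖v‖ = 1 with hP₁
  have hP₁card : (P₁.image f).card = 12 := by
    rw [Finset.card_image_of_injOn (hinj.mono fun v hv => (Finset.mem_filter.1 (Finset.mem_coe.1 hv)).1),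
      card_filter_norm_eq_one_of_twoShellPattern hP]
  -- second-shell images are far, first-shell images are near
  have hfar : ∀ v ∈ P, ‖v‖ = Real.sqrt 2 → (Real.sqrt 2 - ε) * a ≤ dist (x (f v)) (x i) := by
    intro v hv hn
    have := (hdist v hv).1
    rw [hn] at this
    linarith
  have hnear : ∀ v ∈ P, ‖v‖ = 1 → dist (x (f v)) (x i) ≤ (1 + ε) * a := by
    intro v hv hn
    have := (hdist v hv).2
    rw [hn] at this
    linarith
  have hgap : (1 + ε) * a < (Real.sqrt 2 - ε) * a := by
    apply mul_lt_mul_of_pos_right _ ha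
    linarith
  -- both filters coincide with the image of the first shell
  have hset₁ : (Finset.univ.filter fun j : Fin N => j ≠ i ∧ dist (x j) (x i) ≤ (1 + ε) * a) =
      P₁.image f := by
    ext j
    simp only [Finset.mem_filter, Finset.mem_univ, true_and, Finset.mem_image, hP₁]
    constructor
    · rintro ⟨hj, hd⟩
      have hd' : dist (x j) (x i) ≤ 3 / 2 * a := hd.trans (by nlinarith)
      obtain ⟨v, hv, rfl⟩ := hsurj j hj hd'
      refine ⟨v, ⟨hv, ?_⟩, rfl⟩
      rcases norm_of_mem_twoShellPattern hP hv with hn | hn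
      · exact hn
      · exact absurd (hfar v hv hn) (not_le.2 (hd.trans_lt hgap))
    · rintro ⟨v, ⟨hv, hn⟩, rfl⟩
      exact ⟨(hf v hv).1, hnear v hv hn⟩
  have hset₂ : (Finset.univ.filter fun j : Fin N => j ≠ i ∧ dist (x j) (x i) < (Real.sqrt 2 - ε) * a)
      = P₁.image f := by
    ext j
    simp only [Finset.mem_filter, Finset.mem_univ, true_and, Finset.mem_image, hP₁]
    constructor
    · rintro ⟨hj, hd⟩
      have hd' : dist (x j) (x i) ≤ 3 / 2 * a := hd.le.trans (by nlinarith)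
      obtain ⟨v, hv, rfl⟩ := hsurj j hj hd'
      refine ⟨v, ⟨hv, ?_⟩, rfl⟩
      rcases norm_of_mem_twoShellPattern hP hv with hn | hn
      · exact hn
      · exact absurd (hfar v hv hn) (not_le.2 hd)
    · rintro ⟨v, ⟨hv, hn⟩, rfl⟩
      exact ⟨(hf v hv).1, (hnear v hv hn).trans_lt hgap⟩
  rw [hset₁, hset₂, hP₁card]
  exact ⟨rfl, rfl⟩

end IsTwoShellGood

end Literature.Geometry.DiscreteGeometry
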